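import Summits.ResolutionOfSingularities.ResolutionOfSingularities.Theorems.FrobeniusLadderFInjectiveMacaulayficationFHalfRowOfWeaklyNondegenerate
import HarnessLib

/-!
# (W-WND) Q12 (D): THE WEAK CLASS ROW AT AN ARBITRARY MONOMIAL FLOOR — the τ-floors of rows #1–#3 included
# (crux `FInjectiveMacaulayfication` stmt-ResolutionOfSingularities-15315, chain w45a; seat res-L1-w45a-stub-3 g11; res-L1-w45a-plan-1 R21.12 (3)(ii)/(iii) «and at monomial
# admissible floors»; answers res-L1-w45a-tri-2's caveat (b) l.≈82655 «say ‹by the CI engine›, not ‹by the class row›, until a monomial-floor twin is filed» — this is that twin)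

[OURS · L1 W4.5a] Support file (`--supports stmt-ResolutionOfSingularities-15315 --as helper`); def-free; UNCONDITIONAL (the toric cover is explicit data); no named fact; NOT a
statement of any manuscript. Nothing of the crux is proved. AI-written (AI review weaker than expert review).

WHAT. ✓ `FHalfRowOfNewtonNondegenerate.fHalfRow_of_weaklyNondegenerate` (B′) is typed for the POINT floor `𝔪̃` (`I_A = 𝔪·K_A`). Its §2 engine
`affineBlowup_fullCl_of_weaklyNondegenerate` is floor-agnostic (any monomial generator set `A` with pure powers whose unimodular chart cover refines the dual Newton fan of
`f`), and res-L1-w45a-stub-3's row export `FHalfRowOfProductCentre.fHalfConclusion_of_affineBlowup_mul` (p618085 §2) takes ANY floor ideal `τ`. Hence: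
* ★★★ `fHalfRow_monomialFloor_of_weaklyNondegenerate` — `k = k̄` of characteristic `p`; `f` prime, WEAKLY non-degenerate along every positive weight, no variable a multiple
  of `f`, `X = V(f)` regular off the origin `v`; a MONOMIAL floor `I_T = (x^e : e ∈ T)`, `T ≠ ∅` (for the F-half's input side `T` should be `𝔪`-primary — not needed here);
  toric cover data for `I_A = I_T · K_A` (`K_A ∋` a pure power of every variable) refining the dual Newton fan. THEN for EVERY blowing up `g : S′ → Spec 𝒪_{X,v}` along
  `Ĩ_T|_{Spec 𝒪_{X,v}}` there is `𝓚 ≠ ⊥` on `S′`, supported over the closed point, ALL of whose blowings up are FULL at every stalk.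
The τ-floors of rows #1–#3 (`τ(P2d4C) = (x̄², ȳ, ū, t̄, z̄)` etc.) are monomial and their beds are weakly non-degenerate ((C) `CensusBedsWeaklyNondegenerate.weaklyNondegenerate_bed42`),
so — GIVEN a Σ_f-refining unimodular cover of `Bl_{τ·K}` in this currency — each such row's cure half is ONE application of this theorem (R21.12 (3)(ii) RETRO-FIT).
[cite: IshiiSingularities2018, Thm. 4.4.23, Lemma 4.4.24, Cor. 4.4.25 (pp. 95–97)] [cite: GortzWedhorn2020, Prop. 13.92 and (13.19)] [cite: StacksProject, Tag 080A]
-/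

-- single-problem summit: the doubled namespace component is forced
set_option linter.dupNamespace false

noncomputable section

open AlgebraicGeometry CategoryTheory Literature.AlgebraicGeometry.Resolution TopologicalSpace IsLocalRing MvPolynomial

namespace Summit.ResolutionOfSingularities.ResolutionOfSingularities.Theorems.FInjectiveMacaulayfication.FHalfRowOfNewtonNondegenerate

open Summit.ResolutionOfSingularities.ResolutionOfSingularities.Theorems.FInjectiveMacaulayfication
open Literature.AlgebraicGeometry.Resolution.BoubakriGreuelMarkwig SliceableCentre

variable (p : ℕ) [Fact p.Prime] (k : Type) [Field k] [IsAlgClosed k] [CharP k p] {n : ℕ}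

set_option maxHeartbeats 800000 in
-- one product rewrite + the p618085 row export
/-- ★★★ **THE CLASS ROW AT A MONOMIAL FLOOR, TJURINA VERSION.** As `fHalfRow_of_weaklyNondegenerate`, with the point floor `𝔪̃` replaced by an arbitrary non-empty MONOMIAL
floor `I_T = (x^e : e ∈ T)` and `I_A = I_T · K_A`: for EVERY blowing up `g : S′ → Spec 𝒪_{X,v}` along `Ĩ_T|_{Spec 𝒪_{X,v}}` there is `𝓚 ≠ ⊥` on `S′`, supported over the closed
point, such that EVERY blowing up of `S′` along `𝓚` is FULL AT EVERY STALK (indeed regular). (B′ §3's text with the floor generalised.) [OURS · assembly; cite: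
IshiiSingularities2018, Thm. 4.4.23 and Cor. 4.4.25; GortzWedhorn2020, Prop. 13.92 and (13.19); StacksProject, Tag 080A] -/
theorem fHalfRow_monomialFloor_of_weaklyNondegenerate (hn : 0 < n) (f : MvPolynomial (Fin n) k) (hfp : Prime f)
    (hWND : ∀ w : Fin n → ℝ, (∀ i, 0 < w i) → IsWeaklyNondegenerateAlong w (f : MvPowerSeries (Fin n) k))
    (hXne : ∀ v : Fin n, Ideal.Quotient.mk (Ideal.span {f}) (X v) ≠ 0)
    (hreg : ∀ x : Spec (.of (MvPolynomial (Fin n) k ⧸ Ideal.span {f})),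
      ¬ Ideal.span (Set.range fun j : Fin n => Ideal.Quotient.mk (Ideal.span {f}) (X j)) ≤ x.asIdeal → IsRegularLocalRing (Localization.AtPrime x.asIdeal))
    (T A KA : Finset (Fin n →₀ ℕ)) (hTne : T.Nonempty)
    (hIA : Ideal.span ((fun e : Fin n →₀ ℕ => Ideal.Quotient.mk (Ideal.span {f}) (monomial e (1 : k))) '' (A : Set (Fin n →₀ ℕ))) =
      Ideal.span ((fun e : Fin n →₀ ℕ => Ideal.Quotient.mk (Ideal.span {f}) (monomial e (1 : k))) '' (T : Set (Fin n →₀ ℕ))) *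
        Ideal.span ((fun e : Fin n →₀ ℕ => Ideal.Quotient.mk (Ideal.span {f}) (monomial e (1 : k))) '' (KA : Set (Fin n →₀ ℕ))))
    (hKprim : ∀ j : Fin n, ∃ N : ℕ, Finsupp.single j N ∈ KA)
    (hprim : ∀ j ∈ (Finset.univ : Finset (Fin n)), ∃ N : ℕ, Finsupp.single j N ∈ A)
    (hAJ : ∀ a ∈ A, ∃ j ∈ (Finset.univ : Finset (Fin n)), 0 < a j)
    (t : ℕ) (m : Fin t → (Fin n →₀ ℕ))
    (hcov : ∀ a ∈ A, ∃ (c : Fin t) (K : ℕ), 1 ≤ K ∧ ∃ y ∈ (Ideal.span ((fun b : Fin n →₀ ℕ => (MvPolynomial.monomial b (1 : k) : MvPolynomial (Fin n) k)) '' (A : Set (Fin n →₀ ℕ)))) ^ (K - 1),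
      (MvPolynomial.monomial a (1 : k) : MvPolynomial (Fin n) k) ^ K = MvPolynomial.monomial (m c) 1 * y)
    (V : Fin t → Matrix (Fin n) (Fin n) ℕ) (hV : ∀ c, IsUnit ((V c).map (Nat.cast : ℕ → ℤ)).det)
    (a : Fin t → Fin n → (Fin n →₀ ℕ)) (haA : ∀ c i, a c i ∈ A)
    (hgen : ∀ (c : Fin t) (i : Fin n), (Finsupp.equivFunOnFinite.symm ((V c).mulVec ⇑(a c i)) : Fin n →₀ ℕ) =
      Finsupp.equivFunOnFinite.symm ((V c).mulVec ⇑(m c)) + Finsupp.single i 1)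
    (hge : ∀ (c : Fin t), ∀ e ∈ A, (Finsupp.equivFunOnFinite.symm ((V c).mulVec ⇑(m c)) : Fin n →₀ ℕ) ≤ Finsupp.equivFunOnFinite.symm ((V c).mulVec ⇑e))
    (g : Fin t → MvPolynomial (Fin n) k) (d : Fin t → (Fin n →₀ ℕ))
    (hθ : ∀ c, aeval (fun j : Fin n => ∏ i : Fin n, (X i : MvPolynomial (Fin n) k) ^ V c i j) f = monomial (d c) 1 * g c)
    (hg0 : ∀ c, constantCoeff (g c) ≠ 0)
    (hv : ∀ c : Fin t, Ideal.Quotient.mk (Ideal.span {f}) (monomial (m c) (1 : k)) ∈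
      Ideal.span ((fun e : Fin n →₀ ℕ => Ideal.Quotient.mk (Ideal.span {f}) (monomial e (1 : k))) '' (A : Set (Fin n →₀ ℕ))))
    (v : Spec (.of (MvPolynomial (Fin n) k ⧸ Ideal.span {f})))
    (hvm : v.asIdeal = Ideal.span (Set.range fun j : Fin n => Ideal.Quotient.mk (Ideal.span {f}) (X j))) :
    ∀ (S' : Scheme.{0}) (gS : S' ⟶ Spec ((Spec (.of (MvPolynomial (Fin n) k ⧸ Ideal.span {f}))).presheaf.stalk v)),
      IsBlowup gS ((affineBlowup.idealSheaf (Ideal.span ((fun e : Fin n →₀ ℕ => Ideal.Quotient.mk (Ideal.span {f}) (monomial e (1 : k))) '' (T : Set (Fin n →₀ ℕ))))).comap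
        ((Spec (.of (MvPolynomial (Fin n) k ⧸ Ideal.span {f}))).fromSpecStalk v)) →
      ∃ 𝓚 : S'.IdealSheafData, 𝓚 ≠ ⊥ ∧
        (∀ s ∈ (𝓚.support : Set S'), gS.base s = closedPoint ((Spec (.of (MvPolynomial (Fin n) k ⧸ Ideal.span {f}))).presheaf.stalk v)) ∧
        ∀ (S'' : Scheme.{0}) (π : S'' ⟶ S'), IsBlowup π 𝓚 → ∀ s : S'', FullCl p (S''.presheaf.stalk s) := by
  classical
  haveI hfprime : (Ideal.span {f}).IsPrime := (Ideal.span_singleton_prime hfp.ne_zero).mpr hfp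
  haveI : IsDomain (MvPolynomial (Fin n) k ⧸ Ideal.span {f}) := Ideal.Quotient.isDomain _
  have hmono : ∀ e : Fin n →₀ ℕ, Ideal.Quotient.mk (Ideal.span {f}) (monomial e (1 : k)) ≠ 0 := fun e =>
    CIConeFiModelCore.mk_monomial_ne_zero (Ideal.span {f}) hXne e
  -- `τ = 𝔪 ≠ ⊥`, `K ≠ ⊥`, `v ⊆ √K`
  have hτ : Ideal.span ((fun e : Fin n →₀ ℕ => Ideal.Quotient.mk (Ideal.span {f}) (monomial e (1 : k))) '' (T : Set (Fin n →₀ ℕ))) ≠ ⊥ := by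
    intro h0
    obtain ⟨e₀, he₀⟩ := hTne
    exact hmono _ ((Submodule.eq_bot_iff _).mp h0 _ (Ideal.subset_span ⟨_, he₀, rfl⟩))
  have hK : Ideal.span ((fun e : Fin n →₀ ℕ => Ideal.Quotient.mk (Ideal.span {f}) (monomial e (1 : k))) '' (KA : Set (Fin n →₀ ℕ))) ≠ ⊥ := by
    intro h0
    obtain ⟨N, hN⟩ := hKprim ⟨0, hn⟩
    exact hmono _ ((Submodule.eq_bot_iff _).mp h0 _ (Ideal.subset_span ⟨_, hN, rfl⟩))
  have hvK : v.asIdeal ≤ (Ideal.span ((fun e : Fin n →₀ ℕ => Ideal.Quotient.mk (Ideal.span {f}) (monomial e (1 : k))) '' (KA : Set (Fin n →₀ ℕ)))).radical := by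
    rw [hvm, Ideal.span_le]
    rintro _ ⟨j, rfl⟩
    obtain ⟨N, hN⟩ := hKprim j
    exact ⟨N, by rw [← map_pow, X_pow_eq_monomial]; exact Ideal.subset_span ⟨_, hN, rfl⟩⟩
  have hrow : ∀ y : ↥(affineBlowup (Ideal.span ((fun e : Fin n →₀ ℕ => Ideal.Quotient.mk (Ideal.span {f}) (monomial e (1 : k))) '' (T : Set (Fin n →₀ ℕ))) *
      Ideal.span ((fun e : Fin n →₀ ℕ => Ideal.Quotient.mk (Ideal.span {f}) (monomial e (1 : k))) '' (KA : Set (Fin n →₀ ℕ))))),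
      FullCl p ((affineBlowup (Ideal.span ((fun e : Fin n →₀ ℕ => Ideal.Quotient.mk (Ideal.span {f}) (monomial e (1 : k))) '' (T : Set (Fin n →₀ ℕ))) *
        Ideal.span ((fun e : Fin n →₀ ℕ => Ideal.Quotient.mk (Ideal.span {f}) (monomial e (1 : k))) '' (KA : Set (Fin n →₀ ℕ))))).presheaf.stalk y) := by
    rw [← hIA]
    exact affineBlowup_fullCl_of_weaklyNondegenerate p k f hfp hWND hXne hreg A hprim hAJ t m hcov V hV a haA hgen hge g d hθ hg0 hv
  exact FHalfRowOfProductCentre.fHalfConclusion_of_affineBlowup_mul p _ _ hτ hK v hvK hrow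

end Summit.ResolutionOfSingularities.ResolutionOfSingularities.Theorems.FInjectiveMacaulayfication.FHalfRowOfNewtonNondegenerate

end
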